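import Literature.Algebra.EuclideanLattices.KhotGapInstance
import Literature.Algebra.EuclideanLattices.KhotBasicReduction
import HarnessLib

/-!
# Khot 2005: the boosted lattices as integer matrices, and recoverability of the coefficients (for the padding to a square basis)

Topic `Algebra/EuclideanLattices`, namespace `Literature.Algebra.EuclideanLattices.Khot`. Seventh
brick of the decomposition of `Literature.Algebra.EuclideanLattices.gapSVP_const_isNPHardRandomized`
(pqc.S17) through `Khot2005_SAT_randReducible_gapSVP`. It supplies the hypothesis `Recoverable`
of the padding lemmas of `KhotGapInstance.lean` (`padCols_mulVec_eq_zero`,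
`le_intSqNorm_padCols`) for the matrices the reduction actually outputs — the `k`-fold augmented
tensor powers (`KhotTensorBoost.augPow`) of the final lattice of Thm. 5.1
(`KhotBasicReduction.finBasis (intBasis …)`) — and turns `augPow` into a matrix. All proved:

* `augPow_add` (with the landed `augPow_smul`: `augPow B W j` is `ℤ`-linear), `augPowMatrix B W j`
  (its matrix: column `c` = image of `e_c`), `augPowMatrix_mulVec` (`augPowMatrix · X = augPow X`),
  `augPowMatrix_mulVec_eq_zero` (independent columns).
* `augPad p₀ j` — the padded rows of level `j` from the padded rows `p₀` of the base (side rows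
  over `p₀`, and all main-block rows) — and `recoverable_augPowMatrix`: recoverability with
  distortion `c₁` is inherited by every level (the unpadded side rows expose `B·x` columnwise).
* `basePad e₀` — for Khot's final lattice the padded rows are the universe rows other than one
  `e₀ ∈ U` (the remaining rows — sets, parity, code, `e₀`, last — are as many as the columns) —
  and `recoverable_finBasis_intBasis`: back-substitution through the identity blocks of Figs. 1–4
  (`z = v_N`, `2y = v_S`, `2Q((inc·y)_{e₀} + j₀) = v_{e₀}`, `Q((Pz)_r + 2y'_r) + j₀Qs'_r = v_H`,
  `D(r·B_int x + l₀q) = v_last` with `0 ≤ rᵢ < q`) recovers every coefficient with the explicit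
  distortion `c₁ = n·Q·(4|S| + 3|N| + 5) + 1` (`n` = number of rows of `B_int`), for `Q, D, q ≥ 1`,
  `{0,1}`-data `P, s'`; `intBasis_mulVec_coords` records the blockwise coordinates of `B_int x`.

These are routine consequences of the block structure printed in Khot's Figs. 1–4 (pp. 796–802);
the padding device itself is not in the source (which works with `M × N` bases, §1.3), see the
module docstring of `KhotGapInstance.lean`.

## References

* S. Khot, *Hardness of approximating the shortest vector problem in lattices*, J. ACM 52 (2005)
  789–808, §1.3, Figs. 1–4 (§3, §4, §5.1, §5.2.2), §6.2, §7 Eq. (2).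
-/

namespace Literature.Algebra.EuclideanLattices.Khot

open Matrix Finset

/-! ### `augPow` is additive; its matrix -/

section AugPowMatrix

variable {m n : Type} [Fintype n]

/-- `augPow B W j` is additive (with `augPow_smul`: it is `ℤ`-linear). [cite: Khot2005, §6.2] -/
theorem augPow_add (B : Matrix m n ℤ) (W : ℤ) :
    ∀ (j : ℕ) (X Y : Coef n j → ℤ), augPow B W j (X + Y) = augPow B W j X + augPow B W j Y
  | 0, x, y => by
    rw [augPow_zero, augPow_zero, augPow_zero, Matrix.mulVec_add, smul_add]
  | j + 1, X, Y => by
    have hXY : (Matrix.of fun i c => (X + Y) (i, c)) =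
        (Matrix.of fun i c => X (i, c)) + Matrix.of fun i c => Y (i, c) := by
      ext i c; rfl
    rw [augPow_succ, augPow_succ, augPow_succ, hXY, Matrix.mul_add]
    funext p
    rcases p with p | p
    · rfl
    · show augPow B W j ((B * Matrix.of fun i c => X (i, c)) p.1 + (B * Matrix.of fun i c => Y (i, c)) p.1) p.2 =
        augPow B W j ((B * Matrix.of fun i c => X (i, c)) p.1) p.2 +
          augPow B W j ((B * Matrix.of fun i c => Y (i, c)) p.1) p.2
      rw [augPow_add B W j]
      rfl

variable [DecidableEq n]

/-- `Coef n j` has decidable equality. [cite: Khot2005, §6.2] -/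
instance instDecidableEqCoef : (j : ℕ) → DecidableEq (Coef n j)
  | 0 => inferInstanceAs (DecidableEq n)
  | j + 1 => haveI := instDecidableEqCoef j; inferInstanceAs (DecidableEq (n × Coef n j))

/-- **The matrix of the boosted lattice**: `augPowMatrix B W j` is the integer matrix of the
linear map `augPow B W j` (columns = images of the coordinate vectors), i.e. the basis matrix of
`W · L_{j+1}` in Khot's column convention (§6.2: "`L_j` can be defined as a lattice whose basis
matrix `B_j` is given by …"). [cite: Khot2005, §6.2 and §7 Eq. (2)] -/
def augPowMatrix (B : Matrix m n ℤ) (W : ℤ) (j : ℕ) : Matrix (Out m n j) (Coef n j) ℤ :=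
  Matrix.of fun o c => augPow B W j (Pi.single c 1) o

/-- The matrix acts as the map: `augPowMatrix B W j · X = augPow B W j X` (linearity).
[cite: Khot2005, §6.2] -/
theorem augPowMatrix_mulVec (B : Matrix m n ℤ) (W : ℤ) (j : ℕ) (X : Coef n j → ℤ) :
    augPowMatrix B W j *ᵥ X = augPow B W j X := by
  classical
  -- expand `X` in the coordinate vectors
  have hX : X = ∑ c, X c • (Pi.single c 1 : Coef n j → ℤ) := by
    funext c'
    simp [Finset.sum_apply, Pi.single_apply]
  have hlin : ∀ (s : Finset (Coef n j)) (f : Coef n j → ℤ),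
      augPow B W j (∑ c ∈ s, f c • (Pi.single c 1 : Coef n j → ℤ)) =
        ∑ c ∈ s, f c • augPow B W j (Pi.single c 1) := by
    intro s f
    induction s using Finset.induction_on with
    | empty =>
      rw [Finset.sum_empty, Finset.sum_empty]
      have := augPow_smul B W 0 j (0 : Coef n j → ℤ)
      rw [zero_smul, zero_smul] at this
      exact this
    | insert a s ha ih =>
      rw [Finset.sum_insert ha, Finset.sum_insert ha, augPow_add, augPow_smul, ih]
  conv_rhs => rw [hX, hlin]
  funext o
  simp only [augPowMatrix, Matrix.mulVec, dotProduct, Matrix.of_apply, Finset.sum_apply,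
    Pi.smul_apply, smul_eq_mul]
  exact Finset.sum_congr rfl fun c _ => mul_comm _ _

/-- The columns of `augPowMatrix` are independent when those of `B` are and `W ≠ 0`
(`augPow_eq_zero`). [cite: Khot2005, §6.2] -/
theorem augPowMatrix_mulVec_eq_zero {B : Matrix m n ℤ} (hB : ∀ x, B *ᵥ x = 0 → x = 0) {W : ℤ}
    (hW : W ≠ 0) (j : ℕ) (X : Coef n j → ℤ) (h : augPowMatrix B W j *ᵥ X = 0) : X = 0 :=
  augPow_eq_zero hB hW j X (by rwa [augPowMatrix_mulVec] at h)

end AugPowMatrix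

/-! ### Recoverability of the boosted lattices from that of the base -/

section RecoverableAugPow

variable {m n : Type} [Fintype n] [DecidableEq n]

/-- The padded rows of the level-`j` boosted lattice, from the padded rows `p₀` of the base: at
level `0` the rows of `B` in `p₀`; at level `j+1` the side-block rows `(r, c)` with `r ∈ p₀` and
ALL main-block rows (the coefficients are read off the unpadded side rows, which expose the matrix
`B·x` directly). [folklore] -/
def augPad (p₀ : m → Prop) : (j : ℕ) → Out m n j → Prop
  | 0 => p₀
  | _ + 1 => fun o => Sum.elim (fun rc : m × _ => p₀ rc.1) (fun _ => True) o

/-- Decidability of `augPad`. [folklore] -/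
instance instDecidablePredAugPad (p₀ : m → Prop) [DecidablePred p₀] :
    (j : ℕ) → DecidablePred (augPad (n := n) p₀ j)
  | 0 => inferInstanceAs (DecidablePred p₀)
  | j + 1 => fun o => by
    unfold augPad
    rcases o with rc | o
    · exact inferInstanceAs (Decidable (p₀ rc.1))
    · exact isTrue trivial

/-- **Recoverability is inherited by every boosted level with the same distortion.** If the base
`B` is recoverable from its unpadded rows with distortion `c₁` and `W ≥ 1`, then so is
`augPowMatrix B W j` from the rows outside `augPad p₀ j`: at level `0`, `|W(Bx)_r| ≤ t` gives
`|(Bx)_r| ≤ t`; at level `j+1`, the unpadded side rows `(r, c)` carry `(B x_c)_r` for the column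
`x_c` of the coefficient matrix, so each column is recovered by the base. [folklore] -/
theorem recoverable_augPowMatrix {B : Matrix m n ℤ} {p₀ : m → Prop} {c₁ : ℤ}
    (hrec : Recoverable B p₀ c₁) {W : ℤ} (hW : 1 ≤ W) :
    ∀ j : ℕ, Recoverable (augPowMatrix B W j) (augPad p₀ j) c₁
  | 0 => by
    intro x t ht c
    refine hrec x t (fun r hr => ?_) c
    have h := ht r hr
    rw [augPowMatrix_mulVec, augPow_zero, Pi.smul_apply, smul_eq_mul, abs_mul] at h
    calc |(B *ᵥ x) r| = 1 * |(B *ᵥ x) r| := (one_mul _).symm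
      _ ≤ |W| * |(B *ᵥ x) r| := by
          refine mul_le_mul_of_nonneg_right ?_ (abs_nonneg _)
          rw [abs_of_pos (by omega)]; exact hW
      _ ≤ t := h
  | j + 1 => by
    intro X t ht c
    obtain ⟨i, c'⟩ := c
    -- the column `c'` of the coefficient matrix is recovered from the side rows `(r, c')`
    refine hrec (fun i' => X (i', c')) t (fun r hr => ?_) i
    have h := ht (Sum.inl (r, c')) hr
    rw [augPowMatrix_mulVec, augPow_succ, Sum.elim_inl] at h
    rwa [← mul_of_col B X c']

end RecoverableAugPow

/-! ### Recoverability of Khot's final lattice from the rows outside the universe block -/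

section RecoverableBase

variable {U S H Nn : Type} [Fintype U] [Fintype S] [Fintype H] [Fintype Nn]
variable [DecidableEq U] [DecidableEq S] [DecidableEq H] [DecidableEq Nn]

omit [Fintype U] in
/-- The coordinates of a vector of the intermediate lattice, blockwise (Khot 2005, §5.1, Fig. 3):
universe rows `2Q((inc·y)_e + j₀)`, set rows `2y_j`, parity rows `Q((Pz)_r + 2y'_r) + j₀Qs'_r`,
code rows `z_i`. [cite: Khot2005, §5.1 (Fig. 3)] -/
theorem intBasis_mulVec_coords (Q : ℤ) (F : S → Finset U) (P : Matrix H Nn ℤ) (s' : H → ℤ)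
    (y : S → ℤ) (z : Nn → ℤ) (y' : H → ℤ) (j₀ : ℤ) :
    (∀ e, (intBasis Q F P s' *ᵥ intCoeff y z y' j₀) (Sum.inl (Sum.inl e)) =
        2 * (Q * (incidence F *ᵥ y) e + j₀ * Q)) ∧
    (∀ j, (intBasis Q F P s' *ᵥ intCoeff y z y' j₀) (Sum.inl (Sum.inr j)) = 2 * y j) ∧
    (∀ r, (intBasis Q F P s' *ᵥ intCoeff y z y' j₀) (Sum.inr (Sum.inl r)) =
        Q * ((P *ᵥ z) r + 2 * y' r) + j₀ * (Q * s' r)) ∧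
    (∀ i, (intBasis Q F P s' *ᵥ intCoeff y z y' j₀) (Sum.inr (Sum.inr i)) = z i) := by
  rw [intBasis_mulVec, cvpBasis_mulVec, bchBasis_mulVec]
  refine ⟨fun e => ?_, fun j => ?_, fun r => ?_, fun i => ?_⟩
  · simp [cvpTarget, mul_add]
  · simp [cvpTarget]
  · simp [bchShift, mul_add]
  · simp [bchShift]

/-- The PADDED rows of the final lattice: the universe rows other than a chosen `e₀ ∈ U`
(the unpadded rows — sets, parity, code, `e₀`, and the last row — are as many as the columns,
and the coefficients are read off them by back-substitution). [folklore] -/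
def basePad (e₀ : U) : ((U ⊕ S) ⊕ (H ⊕ Nn)) ⊕ Unit → Prop :=
  fun i => ∃ e, i = Sum.inl (Sum.inl (Sum.inl e)) ∧ e ≠ e₀

/-- `basePad` is decidable. [folklore] -/
instance instDecidablePredBasePad (e₀ : U) : DecidablePred (basePad (S := S) (H := H) (Nn := Nn) e₀) :=
  fun i => by
    unfold basePad
    rcases i with ((e | j) | (r | i)) | u
    · exact decidable_of_iff (e ≠ e₀) ⟨fun h => ⟨e, rfl, h⟩, fun ⟨e', he', hne⟩ => by
        cases he'; exact hne⟩
    all_goals exact isFalse fun ⟨e, he, _⟩ => by cases he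

/-- An integer bound `|k·a| ≤ t` with `k ≥ 1` gives `|a| ≤ t`. [folklore] -/
theorem abs_le_of_abs_mul_le {k a t : ℤ} (hk : 1 ≤ k) (h : |k * a| ≤ t) : |a| ≤ t := by
  rw [abs_mul, abs_of_pos (by omega)] at h
  have : 1 * |a| ≤ k * |a| := mul_le_mul_of_nonneg_right hk (abs_nonneg _)
  linarith

omit [Fintype U] [DecidableEq S] in
/-- `|∑_{j : e ∈ S_j} y_j| ≤ |S| · t` when all `|y_j| ≤ t`. [folklore] -/
theorem abs_incidence_mulVec_le (F : S → Finset U) {y : S → ℤ} {t : ℤ} (hy : ∀ j, |y j| ≤ t)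
    (e : U) : |(incidence F *ᵥ y) e| ≤ Fintype.card S * t := by
  rw [incidence_mulVec]
  calc |∑ j ∈ univ.filter (fun j => e ∈ F j), y j| ≤ ∑ j ∈ univ.filter (fun j => e ∈ F j), |y j| :=
        Finset.abs_sum_le_sum_abs _ _
    _ ≤ ∑ _j ∈ (univ : Finset S), t :=
        (Finset.sum_le_sum_of_subset_of_nonneg (filter_subset _ _) fun j _ _ => abs_nonneg _).trans
          (Finset.sum_le_sum fun j _ => hy j)
    _ = Fintype.card S * t := by rw [Finset.sum_const, nsmul_eq_mul, Finset.card_univ]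

omit [Fintype H] [DecidableEq H] [DecidableEq Nn] in
/-- `|(Pz)_r| ≤ |Nn| · t` for a `{0,1}`-matrix `P` when all `|z_i| ≤ t`. [folklore] -/
theorem abs_P_mulVec_le {P : Matrix H Nn ℤ} (hP01 : ∀ r i, P r i = 0 ∨ P r i = 1) {z : Nn → ℤ}
    {t : ℤ} (hz : ∀ i, |z i| ≤ t) (r : H) : |(P *ᵥ z) r| ≤ Fintype.card Nn * t := by
  simp only [Matrix.mulVec, dotProduct]
  calc |∑ i, P r i * z i| ≤ ∑ i, |P r i * z i| := Finset.abs_sum_le_sum_abs _ _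
    _ ≤ ∑ _i : Nn, t := Finset.sum_le_sum fun i _ => by
        rcases hP01 r i with h | h <;> simp [h, hz i, (abs_nonneg (z i)).trans (hz i)]
    _ = Fintype.card Nn * t := by rw [Finset.sum_const, nsmul_eq_mul, Finset.card_univ]

/-- **Recoverability of the final lattice of Thm. 5.1** (the hypothesis `Recoverable` of
`le_intSqNorm_padCols` / `padCols_mulVec_eq_zero`, `KhotGapInstance.lean`): for `Q, D, q ≥ 1`, a
`{0,1}`-matrix `P`, `s' ∈ {0,1}ʰ` and a row vector `r` with entries in `[0, q)`, the coefficients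
`(y ∘ z ∘ y' ∘ j₀) ∘ l₀` of a vector of `finBasis (intBasis Q F P s') r D q` are bounded by
`c₁ · t` whenever the coordinates on the set rows, parity rows, code rows, the universe row `e₀`
and the last row are bounded by `t`, with the explicit distortion
`c₁ = n·Q·(4|S| + 3|Nn| + 5) + 1`, `n` the number of rows of `B_int` (back-substitution:
`z = v_N`, `2y = v_S`, `2Q((inc·y)_{e₀} + j₀) = v_{e₀}`, `Q((Pz)_r + 2y'_r) + j₀Qs'_r = v_H`,
`D(r·B_int x + l₀q) = v_last` with `0 ≤ r_i < q`). [folklore] -/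
theorem recoverable_finBasis_intBasis {Q : ℤ} (hQ : 1 ≤ Q) (F : S → Finset U) {P : Matrix H Nn ℤ}
    (hP01 : ∀ r i, P r i = 0 ∨ P r i = 1) {s' : H → ℤ} (hs01 : ∀ r, s' r = 0 ∨ s' r = 1)
    {rrow : (U ⊕ S) ⊕ (H ⊕ Nn) → ℤ} {q : ℤ} (hq : 1 ≤ q) (hr : ∀ i, 0 ≤ rrow i ∧ rrow i < q)
    {D : ℤ} (hD : 1 ≤ D) (e₀ : U) :
    Recoverable (finBasis (intBasis Q F P s') rrow D q) (basePad e₀)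
      (Fintype.card ((U ⊕ S) ⊕ (H ⊕ Nn)) * Q * (4 * Fintype.card S + 3 * Fintype.card Nn + 5) + 1) := by
  intro x' t ht
  -- decompose the coefficient vector
  have hx'eq : x' = Sum.elim (x' ∘ Sum.inl) (fun _ => x' (Sum.inr ())) := by
    funext i; rcases i with i | ⟨⟩ <;> rfl
  set x := x' ∘ Sum.inl with hxdef
  set l₀ := x' (Sum.inr ()) with hl₀def
  set y : S → ℤ := fun j => x (Sum.inl (Sum.inl j)) with hydef
  set z : Nn → ℤ := fun i => x (Sum.inl (Sum.inr (Sum.inl i))) with hzdef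
  set y' : H → ℤ := fun r => x (Sum.inl (Sum.inr (Sum.inr r))) with hy'def
  set j₀ : ℤ := x (Sum.inr ()) with hj₀def
  have hxparts : x = intCoeff y z y' j₀ := intCoeff_parts x
  set w := intBasis Q F P s' *ᵥ x with hwdef
  have hv : finBasis (intBasis Q F P s') rrow D q *ᵥ x' =
      Sum.elim w fun _ => D * (rrow ⬝ᵥ w + l₀ * q) := by
    rw [hx'eq, finBasis_mulVec]
  obtain ⟨hU0, hS0, hH0, hN0⟩ := intBasis_mulVec_coords Q F P s' y z y' j₀
  rw [← hxparts] at hU0 hS0 hH0 hN0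
  have hU : ∀ e, w (Sum.inl (Sum.inl e)) = 2 * (Q * (incidence F *ᵥ y) e + j₀ * Q) := hU0
  have hS : ∀ j, w (Sum.inl (Sum.inr j)) = 2 * y j := hS0
  have hH : ∀ r, w (Sum.inr (Sum.inl r)) = Q * ((P *ᵥ z) r + 2 * y' r) + j₀ * (Q * s' r) := hH0
  have hN : ∀ i, w (Sum.inr (Sum.inr i)) = z i := hN0
  -- the unpadded coordinate bounds
  have hbound : ∀ i, ¬basePad e₀ i → |(Sum.elim w fun _ : Unit => D * (rrow ⬝ᵥ w + l₀ * q)) i| ≤ t :=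
    fun i hi => hv ▸ ht i hi
  have hlast : |D * (rrow ⬝ᵥ w + l₀ * q)| ≤ t := hbound (Sum.inr ()) (fun ⟨e, he, _⟩ => by cases he)
  have ht0 : 0 ≤ t := (abs_nonneg _).trans hlast
  have hz : ∀ i, |z i| ≤ t := fun i => by
    have := hbound (Sum.inl (Sum.inr (Sum.inr i))) (fun ⟨e, he, _⟩ => by cases he)
    rwa [Sum.elim_inl, hN i] at this
  have hy : ∀ j, |y j| ≤ t := fun j => by
    have := hbound (Sum.inl (Sum.inl (Sum.inr j))) (fun ⟨e, he, _⟩ => by cases he)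
    rw [Sum.elim_inl, hS j] at this
    exact abs_le_of_abs_mul_le (by norm_num) this
  have hj₀ : |j₀| ≤ (Fintype.card S + 1) * t := by
    have := hbound (Sum.inl (Sum.inl (Sum.inl e₀))) (fun ⟨e, he, hne⟩ => by cases he; exact hne rfl)
    rw [Sum.elim_inl, hU e₀] at this
    have h1 : |(incidence F *ᵥ y) e₀ + j₀| ≤ t := by
      have h2 := abs_le_of_abs_mul_le (by norm_num : (1 : ℤ) ≤ 2) this
      rw [show Q * (incidence F *ᵥ y) e₀ + j₀ * Q = Q * ((incidence F *ᵥ y) e₀ + j₀) by ring] at h2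
      exact abs_le_of_abs_mul_le hQ h2
    have h3 := abs_incidence_mulVec_le F hy e₀
    have h4 : |j₀| ≤ |(incidence F *ᵥ y) e₀ + j₀| + |(incidence F *ᵥ y) e₀| := by
      have := abs_sub ((incidence F *ᵥ y) e₀ + j₀) ((incidence F *ᵥ y) e₀)
      rwa [add_sub_cancel_left] at this
    nlinarith
  have hy' : ∀ r, |y' r| ≤ (Fintype.card Nn + Fintype.card S + 2) * t := fun r => by
    have := hbound (Sum.inl (Sum.inr (Sum.inl r))) (fun ⟨e, he, _⟩ => by cases he)
    rw [Sum.elim_inl, hH r] at this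
    have h1 : |(P *ᵥ z) r + 2 * y' r + j₀ * s' r| ≤ t := by
      rw [show Q * ((P *ᵥ z) r + 2 * y' r) + j₀ * (Q * s' r) = Q * ((P *ᵥ z) r + 2 * y' r + j₀ * s' r) by ring] at this
      exact abs_le_of_abs_mul_le hQ this
    have h2 := abs_P_mulVec_le hP01 hz r
    have h3 : |j₀ * s' r| ≤ (Fintype.card S + 1) * t := by
      rcases hs01 r with h | h <;> simp [h, hj₀]
      positivity
    have h4 : |2 * y' r| ≤ t + Fintype.card Nn * t + (Fintype.card S + 1) * t := by
      have := abs_add_three ((P *ᵥ z) r + 2 * y' r + j₀ * s' r) (-(P *ᵥ z) r) (-(j₀ * s' r))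
      rw [abs_neg, abs_neg, show (P *ᵥ z) r + 2 * y' r + j₀ * s' r + -(P *ᵥ z) r + -(j₀ * s' r) = 2 * y' r by ring] at this
      linarith
    rw [abs_mul, abs_two] at h4
    have : (0 : ℤ) ≤ |y' r| := abs_nonneg _
    nlinarith
  -- all coordinates of `w` are at most `G·t / n` … precisely `Q(4|S| + 3|Nn| + 5)·t`
  set M₀ : ℤ := Q * (4 * Fintype.card S + 3 * Fintype.card Nn + 5) with hM₀
  have hcS : (0 : ℤ) ≤ Fintype.card S := Nat.cast_nonneg _
  have hcN : (0 : ℤ) ≤ Fintype.card Nn := Nat.cast_nonneg _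
  have hw_le : ∀ i, |w i| ≤ M₀ * t := by
    have hQt : 0 ≤ Q * t := mul_nonneg (by omega) ht0
    have hM₀t : M₀ * t = (Q * t) * (4 * Fintype.card S + 3 * Fintype.card Nn + 5) := by rw [hM₀]; ring
    intro i
    rcases i with (e | j) | (r | i)
    · rw [hU e, abs_mul, abs_two]
      have h1 := abs_incidence_mulVec_le F hy e
      have h2 : |Q * (incidence F *ᵥ y) e + j₀ * Q| ≤ (Q * t) * (2 * Fintype.card S + 1) := by
        calc |Q * (incidence F *ᵥ y) e + j₀ * Q| ≤ |Q * (incidence F *ᵥ y) e| + |j₀ * Q| := abs_add_le _ _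
          _ ≤ Q * (Fintype.card S * t) + (Fintype.card S + 1) * t * Q := by
              rw [abs_mul, abs_mul, abs_of_pos (by omega : (0 : ℤ) < Q)]
              gcongr
          _ = (Q * t) * (2 * Fintype.card S + 1) := by ring
      calc 2 * |Q * (incidence F *ᵥ y) e + j₀ * Q| ≤ 2 * ((Q * t) * (2 * Fintype.card S + 1)) := by linarith
        _ = (Q * t) * (4 * Fintype.card S + 2) := by ring
        _ ≤ (Q * t) * (4 * Fintype.card S + 3 * Fintype.card Nn + 5) :=
            mul_le_mul_of_nonneg_left (by linarith) hQt
        _ = M₀ * t := hM₀t.symm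
    · rw [hS j, abs_mul, abs_two]
      have hM₀2 : 2 ≤ M₀ := by rw [hM₀]; nlinarith
      calc 2 * |y j| ≤ 2 * t := by linarith [hy j]
        _ ≤ M₀ * t := mul_le_mul_of_nonneg_right hM₀2 ht0
    · rw [hH r]
      have h1 := abs_P_mulVec_le hP01 hz r
      have h2 := hy' r
      have h3 : |j₀ * (Q * s' r)| ≤ (Q * t) * (Fintype.card S + 1) := by
        rcases hs01 r with h | h
        · rw [h]; simp; positivity
        · rw [h, mul_one, abs_mul, abs_of_pos (by omega : (0 : ℤ) < Q)]; nlinarith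
      calc |Q * ((P *ᵥ z) r + 2 * y' r) + j₀ * (Q * s' r)|
          ≤ |Q * ((P *ᵥ z) r + 2 * y' r)| + |j₀ * (Q * s' r)| := abs_add_le _ _
        _ ≤ Q * (Fintype.card Nn * t + 2 * ((Fintype.card Nn + Fintype.card S + 2) * t)) +
              (Q * t) * (Fintype.card S + 1) := by
            gcongr
            rw [abs_mul, abs_of_pos (by omega : (0 : ℤ) < Q)]
            gcongr
            calc |(P *ᵥ z) r + 2 * y' r| ≤ |(P *ᵥ z) r| + |2 * y' r| := abs_add_le _ _
              _ ≤ Fintype.card Nn * t + 2 * ((Fintype.card Nn + Fintype.card S + 2) * t) := by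
                  rw [abs_mul, abs_two]; gcongr
        _ = (Q * t) * (3 * Fintype.card S + 3 * Fintype.card Nn + 5) := by ring
        _ ≤ (Q * t) * (4 * Fintype.card S + 3 * Fintype.card Nn + 5) :=
            mul_le_mul_of_nonneg_left (by linarith) hQt
        _ = M₀ * t := hM₀t.symm
    · rw [hN i]
      have hM₀1 : 1 ≤ M₀ := by rw [hM₀]; nlinarith
      calc |z i| ≤ t := hz i
        _ = 1 * t := (one_mul t).symm
        _ ≤ M₀ * t := mul_le_mul_of_nonneg_right hM₀1 ht0
  -- the last row: `|l₀| q ≤ t + (q-1)·∑|w_i|`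
  have hl₀ : |l₀| ≤ (Fintype.card ((U ⊕ S) ⊕ (H ⊕ Nn)) * M₀ + 1) * t := by
    have h1 : |rrow ⬝ᵥ w + l₀ * q| ≤ t := abs_le_of_abs_mul_le hD hlast
    have h2 : |rrow ⬝ᵥ w| ≤ (q - 1) * (Fintype.card ((U ⊕ S) ⊕ (H ⊕ Nn)) * (M₀ * t)) := by
      simp only [dotProduct]
      calc |∑ i, rrow i * w i| ≤ ∑ i, |rrow i * w i| := Finset.abs_sum_le_sum_abs _ _
        _ ≤ ∑ _i : (U ⊕ S) ⊕ (H ⊕ Nn), (q - 1) * (M₀ * t) := Finset.sum_le_sum fun i _ => by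
            rw [abs_mul, abs_of_nonneg (hr i).1]
            have : rrow i ≤ q - 1 := by have := (hr i).2; omega
            exact mul_le_mul this (hw_le i) (abs_nonneg _) (by omega)
        _ = (q - 1) * (Fintype.card ((U ⊕ S) ⊕ (H ⊕ Nn)) * (M₀ * t)) := by
            rw [Finset.sum_const, nsmul_eq_mul, Finset.card_univ]; ring
    have h3 : |l₀ * q| ≤ t + (q - 1) * (Fintype.card ((U ⊕ S) ⊕ (H ⊕ Nn)) * (M₀ * t)) := by
      have := abs_sub (rrow ⬝ᵥ w + l₀ * q) (rrow ⬝ᵥ w)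
      rw [add_sub_cancel_left] at this
      linarith
    rw [abs_mul, abs_of_pos (by omega : (0 : ℤ) < q)] at h3
    -- `|l₀| q ≤ t + (q-1) n M₀ t ≤ q (n M₀ + 1) t`
    have hM₀0 : 0 ≤ M₀ := by rw [hM₀]; positivity
    have hnM : (0 : ℤ) ≤ Fintype.card ((U ⊕ S) ⊕ (H ⊕ Nn)) * (M₀ * t) := by positivity
    have htq : t ≤ t * q := le_mul_of_one_le_right ht0 hq
    have hX : (q - 1) * (Fintype.card ((U ⊕ S) ⊕ (H ⊕ Nn)) * (M₀ * t)) ≤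
        q * (Fintype.card ((U ⊕ S) ⊕ (H ⊕ Nn)) * (M₀ * t)) :=
      mul_le_mul_of_nonneg_right (by linarith) hnM
    have h4 : |l₀| * q ≤ ((Fintype.card ((U ⊕ S) ⊕ (H ⊕ Nn)) * M₀ + 1) * t) * q := by
      calc |l₀| * q ≤ t + (q - 1) * (Fintype.card ((U ⊕ S) ⊕ (H ⊕ Nn)) * (M₀ * t)) := h3
        _ ≤ t * q + q * (Fintype.card ((U ⊕ S) ⊕ (H ⊕ Nn)) * (M₀ * t)) := add_le_add htq hX
        _ = ((Fintype.card ((U ⊕ S) ⊕ (H ⊕ Nn)) * M₀ + 1) * t) * q := by ring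
    exact le_of_mul_le_mul_right h4 (by omega)
  -- conclude for every coefficient
  have hbig : ∀ c, |x' c| ≤ (Fintype.card ((U ⊕ S) ⊕ (H ⊕ Nn)) * M₀ + 1) * t := by
    have hM₀1 : (Fintype.card Nn + Fintype.card S + 2) * t ≤ (Fintype.card ((U ⊕ S) ⊕ (H ⊕ Nn)) * M₀ + 1) * t := by
      have hn1 : (1 : ℤ) ≤ Fintype.card ((U ⊕ S) ⊕ (H ⊕ Nn)) := by
        have : 0 < Fintype.card ((U ⊕ S) ⊕ (H ⊕ Nn)) := Fintype.card_pos_iff.2 ⟨Sum.inl (Sum.inl e₀)⟩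
        exact_mod_cast this
      have hM₀0 : 0 ≤ M₀ := by rw [hM₀]; positivity
      have hle : (Fintype.card Nn + Fintype.card S + 2 : ℤ) ≤ M₀ := by rw [hM₀]; nlinarith
      have hnM : M₀ ≤ Fintype.card ((U ⊕ S) ⊕ (H ⊕ Nn)) * M₀ := le_mul_of_one_le_left hM₀0 hn1
      exact mul_le_mul_of_nonneg_right (by linarith) ht0
    intro c
    rcases c with (((j | (i | r))) | u) | u
    · exact (hy j).trans (by nlinarith [hM₀1])
    · exact (hz i).trans (by nlinarith [hM₀1])
    · exact (hy' r).trans hM₀1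
    · rcases u; exact hj₀.trans (by nlinarith [hM₀1])
    · rcases u; exact hl₀
  intro c
  rw [hM₀] at hbig
  convert hbig c using 2
  ring

end RecoverableBase

end Literature.Algebra.EuclideanLattices.Khot
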